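import Literature.Probability.RandomPlanarGeometry.HexSAWPolygonCellsSticks
import Literature.Probability.RandomPlanarGeometry.HexSAWPolygonCellsHosts
import HarnessLib

/-!
# Cell calculus for honeycomb polygon surgery, XXXIV: peel stability — removing a stick top does not change the base

Topic `Literature/Probability/RandomPlanarGeometry` (lane «pcv-sawmu», a-p4 g22; sequel of VI `…CellsPeel` (`peel`, `Peelable`), X `…CellsSticks`
(`sdiff_peel_eq_insert`, `lt_of_mem_peel_of_mem_sdiff`)).

Second third of THEOREM I (injectivity of the step-two injection, `HOME/pub-sawmu-a-p4/g21/omega/THEOREM-OMEGA-g21.md` §4; HANDOFF-gen22.md §3 (b),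
part 2 (β)): the decoder of §4 removes, in its CASE 1, the top hexagon `c` of the stick under the ≺-largest ray top — which need not be the top hexagon of
`S` — and the induction needs the shortened set to have THE SAME BASE:
* ★ `peel_erase_of_stickTop` — for a brick set `S` with `2 ≤ #(peel S)`, a peeled hexagon `c ∈ S \ peel S` with `UR c ∉ S` (a stick top) has
  `peel (S.erase c) = peel S`.
The proof is an induction along the peeling: if `c` is the top `m₀` this is `peel_eq_peel_erase`; otherwise `m₀` stays peelable in `S.erase c` — it is
still the spike top, `S.erase c` is not the 3-chain (its base would be the peelable domino), and the roof-end situation cannot appear below `m₀`: the top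
of `(S.erase m₀).erase c` is either a later spike (no run under it) or the base top `t`, and in the latter case `c = m₁` would sit on the row of `m₀`
strictly between `t` and `m₀ = UR e_{k−1}`, with the two run cells `LL m₁`, `LR m₁` as contacts — not a spike.

Sources: N. Madras, G. Slade, *The Self-Avoiding Walk* (1993), §3.2, proof of Theorem 3.2.3 [MadrasSlade1993]; I. Jensen, J. Phys.: Conf. Ser. 42 (2006) 163
[Jensen2006HoneycombPolygons].  Label (lane): LANE INFRASTRUCTURE for the lane's step-two injection; nothing new in writing.
-/

open Finset

namespace Literature.Probability.RandomPlanarGeometry.SAW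

namespace HexCell

/-- A set with a peeled hexagon is peelable. [cite: MadrasSlade1993, §3.2 (proof of Theorem 3.2.3)] -/
theorem exists_peelable_of_mem_sdiff_peel {S : Finset Cell} {c : Cell} (hc : c ∈ S \ peel S) : ∃ m, Peelable S m := by
  by_contra h
  rw [peel_eq_self h, sdiff_self] at hc
  simp at hc

/-- A spike top has no lower-right contact. [cite: MadrasSlade1993, §3.2 (proof of Theorem 3.2.3)] -/
theorem IsSpikeTop.lr_notMem {S : Finset Cell} {m : Cell} (h : IsSpikeTop S m) : LR m ∉ S := by
  intro hLR
  have hmem : LR m ∈ nbrs m ∩ S := mem_inter.2 ⟨by simp [mem_nbrs_iff, LR], hLR⟩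
  rw [h.2, mem_singleton] at hmem
  have := congrArg Prod.fst hmem
  simp at this
  omega

/-- No roof-end situation under a spike top: the run would start at `LR` of the top. [cite: MadrasSlade1993, §3.2 (proof of Theorem 3.2.3)] -/
theorem not_roofEndSituation_of_isSpikeTop {U : Finset Cell} {m d : Cell} (h : IsSpikeTop U m) : ¬ RoofEndSituation U d := by
  rintro ⟨t, k, ht, -, hk, hrun, -, -⟩
  have e : t = m := ht.unique h.1
  subst e
  have h0 := hrun 0 (by omega)
  exact h.lr_notMem (by simpa [runCell, LR] using h0)

/-- The domino `{p, UR p}` is peelable at `UR p`. [cite: MadrasSlade1993, §3.2 (proof of Theorem 3.2.3)] -/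
theorem peelable_domino (p : Cell) : Peelable ({p, UR p} : Finset Cell) (UR p) := by
  refine ⟨⟨⟨by simp, ?_⟩, ?_⟩, ?_, ?_⟩
  · intro c hc
    simp only [mem_insert, mem_singleton] at hc
    rcases hc with rfl | rfl
    · left; simp
    · right; simp
  · ext d
    simp only [mem_inter, mem_insert, mem_singleton, mem_nbrs_iff]
    constructor
    · rintro ⟨hd, rfl | rfl⟩
      · exact Prod.ext (by simp) (by simp)
      · exfalso
        rcases hd with h | h | h | h | h | h <;> simp [UR, Prod.ext_iff] at h
        omega
    · rintro rfl
      exact ⟨Or.inl (Prod.ext (by simp) (by simp)), Or.inl (Prod.ext (by simp) (by simp))⟩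
  · rintro ⟨t, k, ht, -, hk, hrun, -, -⟩
    have hsub : ({p, UR p} : Finset Cell).erase (UR p) ⊆ {p} := by
      intro x hx
      simp only [mem_erase, mem_insert, mem_singleton] at hx ⊢
      rcases hx with ⟨hne, rfl | rfl⟩
      · rfl
      · exact absurd rfl hne
    have htp : t = p := by simpa using hsub ht.1
    subst htp
    have h0 := hsub (hrun 0 (by omega))
    simp only [mem_singleton, runCell, Prod.ext_iff] at h0
    omega
  · rintro ⟨q, hq⟩
    have hc : #({p, UR p} : Finset Cell) = 2 := by
      rw [card_insert_of_notMem (by simp [Prod.ext_iff, UR]), card_singleton]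
    have hc' : #({q, UR q, UR (UR q)} : Finset Cell) = 3 := by
      rw [card_insert_of_notMem, card_insert_of_notMem, card_singleton]
      · simp only [mem_singleton, Prod.ext_iff, UR_fst, UR_snd]; omega
      · simp only [mem_insert, mem_singleton, Prod.ext_iff, UR_fst, UR_snd]; omega
    rw [hq] at hc
    omega

/-- `LL` of a spike top is never a stick top: its `UR` is the spike. [cite: MadrasSlade1993, §3.2 (proof of Theorem 3.2.3)] -/
theorem ll_ne_of_ur_notMem {S : Finset Cell} {m c : Cell} (hm : m ∈ S) (hc : UR c ∉ S) : LL m ≠ c := by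
  rintro rfl
  exact hc (by rw [show UR (LL m) = m from Prod.ext (by simp) (by simp)]; exact hm)

/-- The spike top stays a spike top after removing another hexagon that is not its contact.
[cite: MadrasSlade1993, §3.2 (proof of Theorem 3.2.3)] -/
theorem IsSpikeTop.erase {S : Finset Cell} {m c : Cell} (h : IsSpikeTop S m) (hmc : m ≠ c) (hLL : LL m ≠ c) :
    IsSpikeTop (S.erase c) m := by
  refine ⟨⟨mem_erase.2 ⟨hmc, h.1.1⟩, fun x hx => h.1.2 x (mem_of_mem_erase hx)⟩, ?_⟩
  ext d
  simp only [mem_inter, mem_erase, mem_singleton]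
  constructor
  · rintro ⟨hd, -, hdS⟩
    have : d ∈ nbrs m ∩ S := mem_inter.2 ⟨hd, hdS⟩
    rw [h.2] at this
    exact mem_singleton.1 this
  · rintro rfl
    have : LL m ∈ nbrs m ∩ S := by rw [h.2]; exact mem_singleton_self _
    exact ⟨(mem_inter.1 this).1, hLL, (mem_inter.1 this).2⟩

/-- The peelable top lies above the peel. [cite: MadrasSlade1993, §3.2 (proof of Theorem 3.2.3)] -/
theorem Peelable.mem_sdiff_peel {S : Finset Cell} {m : Cell} (hm : Peelable S m) : m ∈ S \ peel S := by
  rw [sdiff_peel_eq_insert hm]; exact mem_insert_self _ _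

/-- In the 3-chain `{q, UR q, UR² q}` the top hexagon is `UR² q`. [cite: MadrasSlade1993, §3.2 (proof of Theorem 3.2.3)] -/
theorem eq_ur_ur_of_isLexmax_chain3 {T : Finset Cell} {q m : Cell} (hT : T = {q, UR q, UR (UR q)}) (hm : IsLexmax T m) : m = UR (UR q) := by
  have hmem := hm.1
  have htop := hm.2 (UR (UR q)) (by rw [hT]; simp)
  rw [hT] at hmem
  simp only [mem_insert, mem_singleton] at hmem
  rcases hmem with rfl | rfl | rfl
  · simp at htop; omega
  · simp at htop
  · rfl

/-- The «no roof-end situation below the top» step of peel stability: for a brick set `S₁` (think `S.erase m₀`) with a peeled stick top `c`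
(`UR c ∉ S₁`) and a hexagon `m₀ ∉ S₁` lex-above all of `S₁`: `¬ RoofEndSituation (S₁.erase c) (LL m₀)` — the top of `S₁.erase c` is either a spike
(no run below it) or the base top `t`, and then `c` would sit on the row of `m₀ = UR e_{k−1}` strictly between `t` and `m₀`, with the run cell `LR c`
as a second contact. [cite: MadrasSlade1993, §3.2 (proof of Theorem 3.2.3)] -/
theorem not_roofEndSituation_erase {S₁ : Finset Cell} {c m₀ : Cell} (hS : IsBrickSet S₁)
    (hc : c ∈ S₁ \ peel S₁) (hur : UR c ∉ S₁) (htop : ∀ x ∈ S₁, x.2 < m₀.2 ∨ (x.2 = m₀.2 ∧ x.1 ≤ m₀.1)) (hm₀ : m₀ ∉ S₁) :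
    ¬ RoofEndSituation (S₁.erase c) (LL m₀) := by
  obtain ⟨m₁, hm₁⟩ := exists_peelable_of_mem_sdiff_peel hc
  by_cases e : c = m₁
  · subst e
    by_cases h₂ : ∃ m₂, Peelable (S₁.erase c) m₂
    · obtain ⟨m₂, hm₂⟩ := h₂
      exact not_roofEndSituation_of_isSpikeTop hm₂.1
    · -- `S₁.erase c` is the base
      rintro ⟨t, k, ht, -, hk, hrun, -, hd⟩
      have hB : peel S₁ = S₁.erase c := by rw [peel_eq_peel_erase hm₁, peel_eq_self h₂]
      have htB : t ∈ peel S₁ := by rw [hB]; exact ht.1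
      have hord := lt_of_mem_peel_of_mem_sdiff hc htB
      have hm₀c := htop c hm₁.mem
      have hne : c ≠ m₀ := fun h => hm₀ (h ▸ hm₁.mem)
      have e1 := congrArg Prod.fst hd
      have e2 := congrArg Prod.snd hd
      simp only [LL_fst, LL_snd, runCell_fst, runCell_snd] at e1 e2
      -- rows: `c` is on the row of `m₀ = (t.1 + 2k, t.2)`, strictly between `t` and `m₀`
      have hrow : c.2 = t.2 := by omega
      have hx1 : t.1 < c.1 := by omega
      have hx2 : c.1 < t.1 + 2 * (k : ℤ) := by
        rcases hm₀c with h | ⟨h, h'⟩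
        · omega
        · have : c.1 ≠ m₀.1 := fun hx => hne (Prod.ext hx (by omega))
          omega
      -- parity: `c.1 ≡ t.1 (mod 2)`
      have hct : Even (c.1 - t.1) := by
        have h1 := hS c hm₁.mem
        have h2 := hS t (mem_of_mem_erase ht.1)
        have : c.1 - t.1 = (c.1 + c.2) - (t.1 + t.2) := by rw [hrow]; ring
        rw [this]; exact Int.even_sub.2 (by simp [Int.even_iff] at h1 h2 ⊢; omega)
      obtain ⟨r, hr⟩ := hct
      obtain ⟨i, rfl⟩ : ∃ i : ℕ, r = (i : ℤ) := ⟨r.toNat, by omega⟩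
      have hik : i < k := by omega
      have hmem := mem_of_mem_erase (hrun i hik)
      -- `runCell t i = LR c`, a second contact of the spike `c`
      have hLR : runCell t i = LR c := Prod.ext (by simp; omega) (by simp; omega)
      rw [hLR] at hmem
      exact hm₁.1.lr_notMem hmem
  · -- the top of `S₁.erase c` is the spike `m₁`
    have hm₁c : m₁ ≠ c := fun h => e h.symm
    have hLL : LL m₁ ≠ c := ll_ne_of_ur_notMem hm₁.mem hur
    exact not_roofEndSituation_of_isSpikeTop (hm₁.1.erase hm₁c hLL)

/-- ★★ **PEEL STABILITY**: removing a stick top (a peeled hexagon `c` with `UR c ∉ S`) from a brick set with at least two base hexagons does not change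
the base: `peel (S.erase c) = peel S`. [cite: MadrasSlade1993, §3.2 (proof of Theorem 3.2.3: the surgery is undone spike by spike)] -/
theorem peel_erase_of_stickTop {S : Finset Cell} (hS : IsBrickSet S) (h2 : 2 ≤ #(peel S)) {c : Cell}
    (hc : c ∈ S \ peel S) (hur : UR c ∉ S) : peel (S.erase c) = peel S := by
  induction S using Finset.strongInduction generalizing c with
  | H S ih =>
    obtain ⟨m₀, hm₀⟩ := exists_peelable_of_mem_sdiff_peel hc
    by_cases e : c = m₀
    · subst e; exact (peel_eq_peel_erase hm₀).symm
    have hc' : c ∈ S.erase m₀ \ peel (S.erase m₀) := by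
      have := hc
      rw [sdiff_peel_eq_insert hm₀, mem_insert] at this
      exact this.resolve_left e
    have hm₀c : m₀ ≠ c := fun h => e h.symm
    have hLL : LL m₀ ≠ c := ll_ne_of_ur_notMem hm₀.mem hur
    have hS₁ : IsBrickSet (S.erase m₀) := fun x hx => hS x (mem_of_mem_erase hx)
    have hP : Peelable (S.erase c) m₀ := by
      refine ⟨hm₀.1.erase hm₀c hLL, ?_, ?_⟩
      · rw [erase_right_comm]
        exact not_roofEndSituation_erase hS₁ hc' (fun h => hur (mem_of_mem_erase h)) (fun x hx => hm₀.1.1.2 x (mem_of_mem_erase hx))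
          (notMem_erase m₀ S)
      · rintro ⟨q, hq⟩
        have hm₀T : IsLexmax (S.erase c) m₀ := (hm₀.1.erase hm₀c hLL).1
        have hm₀q := eq_ur_ur_of_isLexmax_chain3 hq hm₀T
        have hsub : peel S ⊆ {q, UR q} := by
          intro b hb
          have hbc : b ≠ c := fun h => (mem_sdiff.1 hc).2 (h ▸ hb)
          have hbm : b ≠ m₀ := fun h => (mem_sdiff.1 hm₀.mem_sdiff_peel).2 (h ▸ hb)
          have hbT : b ∈ S.erase c := mem_erase.2 ⟨hbc, peel_subset S hb⟩
          rw [hq] at hbT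
          simp only [mem_insert, mem_singleton] at hbT ⊢
          rcases hbT with h | h | h
          · exact Or.inl h
          · exact Or.inr h
          · exact absurd (h.trans hm₀q.symm) hbm
        have hcard : #({q, UR q} : Finset Cell) ≤ #(peel S) := by
          rw [card_insert_of_notMem (by simp [Prod.ext_iff, UR]), card_singleton]; exact h2
        have heq : peel S = {q, UR q} := eq_of_subset_of_card_le hsub hcard
        exact not_exists_peelable_peel S ⟨UR q, heq ▸ peelable_domino q⟩
    have h2' : 2 ≤ #(peel (S.erase m₀)) := by rw [← peel_eq_peel_erase hm₀]; exact h2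
    rw [peel_eq_peel_erase hP, erase_right_comm, ih (S.erase m₀) (erase_ssubset hm₀.mem) hS₁ h2' hc' (fun h => hur (mem_of_mem_erase h)),
      ← peel_eq_peel_erase hm₀]

/-- Consequently the peeled part shrinks by exactly `c`. [cite: MadrasSlade1993, §3.2 (proof of Theorem 3.2.3)] -/
theorem sdiff_peel_erase_of_stickTop {S : Finset Cell} (hS : IsBrickSet S) (h2 : 2 ≤ #(peel S)) {c : Cell}
    (hc : c ∈ S \ peel S) (hur : UR c ∉ S) : S.erase c \ peel (S.erase c) = (S \ peel S).erase c := by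
  rw [peel_erase_of_stickTop hS h2 hc hur, erase_sdiff_comm]

end HexCell

end Literature.Probability.RandomPlanarGeometry.SAW
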